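import Summits.CriticalPhenomena.PercolationContinuityZ3.Theorems.PercNearOneGluingAdditiveGluingFingerML3Reductions
import Summits.CriticalPhenomena.PercolationContinuityZ3.Theorems.PercNearOneGluingAdditiveGluingBlockMultiEdgeSplit
import Summits.CriticalPhenomena.PercolationContinuityZ3.Theorems.PercNearOneGluingAdditiveGluingGluePushforward
import HarnessLib

/-! # Crux `PercNearOneGluing.AdditiveGluing` (stmt-CriticalPhenomena-4576) — the UNGLUED multi-finger Lemma 3
# (seat (b) V⁺-form, depth prover `png-dp-vplus`)

Support file (`--supports stmt-CriticalPhenomena-4576`); no definitions, no named facts.  Companion of the registered open stub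
`stub_fingerML3_vp` (`…AdditiveGluingTFingers.lean`) and of `…AdditiveGluingFingerML3Reductions.lean`.

Setting of the stub: `K` a weighting on `Fin n`, relays `A ∋ b`, a finger block `N` (`Disjoint N A`, every positive-weight pair at `N` goes to
`A` or stays inside `N`), `R` = "some pair `N–A` is open", `d ∈ A` with `μ_K(d ↔ b) ≤ μ_K(a ↔ b)` for all `a ∈ A`.

**Theorem (`fingerML3_unglued`).**  `μ_K(R ∩ {d ↔ b}) ≤ μ_K(R ∩ ⋃_{v∈N}{v ↔ b})` — the multi-edge Lemma 3 for a SET of fingers in the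
unglued weighting `K` itself (for `|N| = 1` this is the landed `multiEdge_lemma3_relays`).  The stub asks for the same inequality under the
GLUED measure `μ_{K/N}`, where the left side is larger by the glue gain `μ_K(d ↮ b, d ↔ N, N ↔ b)` and the right side is unchanged; so the
theorem isolates the entire content of `stub_fingerML3_vp` as that glue gain.  Equivalently: the T-functional of the UNGLUED finger set is
non-negative at the designation `d`, `μ_K(N ↮ A) + μ_K(N ↔ b) − μ_K(d ↔ b) ≥ 0` (`T_fingers_unglued_nonneg`).

Proof.  Let `c` minimise the base two-point function `μ_q(· ↔ b)` over `A` (`q` = `K` with the pairs at `N` killed).  Off `R` the block is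
cut off, so `μ_K(R ∩ {v↔b}) = μ_K(v↔b) − μ_K(Rᶜ)·μ_q(v↔b)`; with `μ_K(d↔b) ≤ μ_K(c↔b)` and `μ_q(c↔b) ≤ μ_q(d↔b)` this gives
`μ_K(R ∩ {d↔b}) ≤ μ_K(R ∩ {c↔b})`.  Gluing only helps `c`: `μ_K(R ∩ {c↔b}) ≤ μ_{K/N}(R ∩ {c↔b})` (push-forward), and `c` is the block's
Question-9 designation, so `μ_{K/N}(R ∩ {c↔b}) ≤ μ_{K/N}(R ∩ ⋃_v{v↔b})` (`fingerML3_of_gluedWitness`); finally `⋃_v{v↔b}` does not feel the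
gluing (`glue_preimage_block_reach`).
[cite: KozmaNitzan2024, Lemma 3(i) (pp. 6–7), Lemma 5 (p. 13), §3.1–3.2 pp. 12–14, Question 9 (p. 36)]
-/

namespace Summit.CriticalPhenomena.PercolationContinuityZ3.Theorems

open MeasureTheory Set
open Literature.Probability.LatticeModels (prodBernoulli)
open Literature.Probability.Percolation (BondConfig openConn openGraph openEdgeCluster pinW localCylinder
  DeterminedBy determinedBy_iff)

noncomputable section
open Classical

section FingerUnglued

open Literature.Probability.LatticeModels Literature.Probability.Percolation

variable {n : ℕ}

/-- A walk that reaches `b` after gluing the block `N` ends with a stretch of genuinely open pairs: some vertex `v` (the start, or a vertex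
of `N`) is joined to `b` in `ω` itself. [folklore] -/
theorem exists_reach_of_glue_walk {ω : BondConfig (Fin n)} {N : Finset (Fin n)} {u b : Fin n}
    (p : (openGraph (ω ∪ {e : Sym2 (Fin n) | (∀ x ∈ e, x ∈ N) ∧ ¬ e.IsDiag} : BondConfig (Fin n))).Walk u b) :
    ∃ v : Fin n, (v = u ∨ v ∈ N) ∧ (openGraph ω).Reachable v b := by
  induction p with
  | nil => exact ⟨_, Or.inl rfl, SimpleGraph.Reachable.refl _⟩
  | cons hadj q ih =>
    rename_i u' u₁ _
    obtain ⟨v, hv, hvb⟩ := ih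
    rcases hv with rfl | hvN
    · obtain ⟨hmem, hne⟩ := (openGraph_adj _ u' v).1 hadj
      rcases hmem with hω | hD
      · exact ⟨u', Or.inl rfl, ((openGraph_adj ω u' v).2 ⟨hω, hne⟩).reachable.trans hvb⟩
      · exact ⟨v, Or.inr (hD.1 v (Sym2.mem_mk_right u' v)), hvb⟩
    · exact ⟨v, Or.inr hvN, hvb⟩

/-- **The block's reach does not feel the gluing**: the pull-back of `R ∩ ⋃_{v∈N}{v↔b}` under `ω ↦ ω ∪ clique(N)` is `R ∩ ⋃_{v∈N}{v↔b}`
(`R` = some pair `N–A` open, `A` disjoint from `N`). [folklore] -/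
theorem glue_preimage_block_reach (N A : Finset (Fin n)) (b : Fin n) (hNA : Disjoint N A) :
    {ω : BondConfig (Fin n) | (ω ∪ {e : Sym2 (Fin n) | (∀ x ∈ e, x ∈ N) ∧ ¬ e.IsDiag} : BondConfig (Fin n)) ∈
        ({ω : Set (Sym2 (Fin n)) | ∃ v ∈ N, ∃ a ∈ A, s(v, a) ∈ ω} ∩ ⋃ v ∈ N, openConn v b)} =
      {ω : Set (Sym2 (Fin n)) | ∃ v ∈ N, ∃ a ∈ A, s(v, a) ∈ ω} ∩ ⋃ v ∈ N, openConn v b := by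
  ext ω
  simp only [Set.mem_setOf_eq, Set.mem_inter_iff, Set.mem_iUnion, exists_prop]
  constructor
  · rintro ⟨⟨v, hv, a, ha, hva⟩, ⟨u, hu, hub⟩⟩
    refine ⟨⟨v, hv, a, ha, ?_⟩, ?_⟩
    · rcases hva with h | h
      · exact h
      · exact ((Finset.disjoint_left.1 hNA.symm ha) (h.1 a (Sym2.mem_mk_right v a))).elim
    · obtain ⟨p⟩ := (show (openGraph _).Reachable u b from hub)
      obtain ⟨v', hv', hv'b⟩ := exists_reach_of_glue_walk p
      rcases hv' with rfl | hv'N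
      · exact ⟨v', hu, hv'b⟩
      · exact ⟨v', hv'N, hv'b⟩
  · rintro ⟨⟨v, hv, a, ha, hva⟩, ⟨u, hu, hub⟩⟩
    refine ⟨⟨v, hv, a, ha, Or.inl hva⟩, u, hu, ?_⟩
    exact (show (openGraph ω).Reachable u b from hub).mono (SimpleGraph.fromEdgeSet_mono Set.subset_union_left)

/-- Gluing only helps a two-point event on the contact event: the pull-back of `R ∩ {y↔b}` contains `R ∩ {y↔b}`. [folklore] -/
theorem glue_preimage_contact_openConn_superset (N A : Finset (Fin n)) (y b : Fin n) :
    {ω : Set (Sym2 (Fin n)) | ∃ v ∈ N, ∃ a ∈ A, s(v, a) ∈ ω} ∩ openConn y b ⊆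
      {ω : BondConfig (Fin n) | (ω ∪ {e : Sym2 (Fin n) | (∀ x ∈ e, x ∈ N) ∧ ¬ e.IsDiag} : BondConfig (Fin n)) ∈
        ({ω : Set (Sym2 (Fin n)) | ∃ v ∈ N, ∃ a ∈ A, s(v, a) ∈ ω} ∩ openConn y b)} := by
  rintro ω ⟨⟨v, hv, a, ha, hva⟩, hyb⟩
  simp only [Set.mem_setOf_eq, Set.mem_inter_iff]
  refine ⟨⟨v, hv, a, ha, Or.inl hva⟩, ?_⟩
  exact (show (openGraph ω).Reachable y b from hyb).mono (SimpleGraph.fromEdgeSet_mono Set.subset_union_left)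

/-- **The unglued multi-finger Lemma 3.**  Stub setting (`b, d ∈ A`, finger block `N` disjoint from `A`, `μ_K(d↔b) ≤ μ_K(a↔b)` for all
`a ∈ A`): `μ_K(R ∩ {d↔b}) ≤ μ_K(R ∩ ⋃_{v∈N}{v↔b})` in the UNGLUED weighting `K`.  See the module docstring for the proof.
[cite: KozmaNitzan2024, Lemma 3(i) (pp. 6–7), Lemma 5 (p. 13), Question 9 (p. 36)] -/
theorem fingerML3_unglued (K : Sym2 (Fin n) → unitInterval) (A N : Finset (Fin n)) (d b : Fin n)
    (hb : b ∈ A) (hNA : Disjoint N A) (hd : d ∈ A)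
    (hfree : ∀ v ∈ N, ∀ y : Fin n, y ∉ A → y ∉ N → (K s(v, y) : ℝ) = 0)
    (hle : ∀ a ∈ A, (prodBernoulli K).real (openConn d b) ≤ (prodBernoulli K).real (openConn a b)) :
    (prodBernoulli K).real ({ω : Set (Sym2 (Fin n)) | ∃ v ∈ N, ∃ a ∈ A, s(v, a) ∈ ω} ∩ openConn d b) ≤
      (prodBernoulli K).real ({ω : Set (Sym2 (Fin n)) | ∃ v ∈ N, ∃ a ∈ A, s(v, a) ∈ ω} ∩ ⋃ v ∈ N, openConn v b) := by
  set g : Sym2 (Fin n) → unitInterval := fun e' => if (∀ y ∈ e', y ∈ N) ∧ ¬ e'.IsDiag then 1 else K e' with hg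
  set q : Sym2 (Fin n) → unitInterval := fun e' => if (∃ y ∈ e', y ∈ N) then (0 : unitInterval) else K e' with hq
  set R : Set (BondConfig (Fin n)) := {ω : Set (Sym2 (Fin n)) | ∃ v ∈ N, ∃ a ∈ A, s(v, a) ∈ ω} with hR
  set U : Set (BondConfig (Fin n)) := ⋃ v ∈ N, openConn v b with hU
  set F : Finset (Sym2 (Fin n)) := (N ×ˢ A).image (fun va : Fin n × Fin n => s(va.1, va.2)) with hFdef
  have hmeas : ∀ s : Set (BondConfig (Fin n)), MeasurableSet s := fun _ => MeasurableSet.of_discrete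
  -- K → K/N transfers
  have hRU : (prodBernoulli g).real (R ∩ U) = (prodBernoulli K).real (R ∩ U) := by
    rw [stub_gluePushforward n K N (R ∩ U), glue_preimage_block_reach N A b hNA]
  have hRy : ∀ y : Fin n, (prodBernoulli K).real (R ∩ openConn y b) ≤ (prodBernoulli g).real (R ∩ openConn y b) := by
    intro y
    rw [stub_gluePushforward n K N (R ∩ openConn y b)]
    exact measureReal_mono (glue_preimage_contact_openConn_superset N A y b)
  -- the base (Question-9) designation of the block
  obtain ⟨c, hc, hcmin⟩ := Finset.exists_min_image A (fun a => (prodBernoulli q).real (openConn a b)) ⟨b, hb⟩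
  have hcN : c ∉ N := Finset.disjoint_left.1 hNA.symm hc
  have hstep2 : (prodBernoulli K).real (R ∩ openConn c b) ≤ (prodBernoulli K).real (R ∩ U) := by
    rw [← hRU]
    exact (hRy c).trans (fingerML3_of_gluedWitness K A N c c b hNA hcN hfree hcmin le_rfl)
  by_cases hdc : (prodBernoulli q).real (openConn d b) ≤ (prodBernoulli q).real (openConn c b)
  · -- `d` itself is base-minimal
    have hdA : ∀ a ∈ A, (prodBernoulli q).real (openConn d b) ≤ (prodBernoulli q).real (openConn a b) :=
      fun a ha => hdc.trans (hcmin a ha)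
    rw [← hRU]
    exact (hRy d).trans (fingerML3_of_qMinimal K A N d b hNA hd hfree hdA)
  · -- `μ_K(R ∩ d b) ≤ μ_K(R ∩ c b)`: off `R` the block is cut off and the base is `q`
    have hcd : (prodBernoulli q).real (openConn c b) ≤ (prodBernoulli q).real (openConn d b) := le_of_lt (not_le.1 hdc)
    -- the base weighting `pinW K F ∅` and `q` agree off the block and both cut the block off
    set w₀ : Sym2 (Fin n) → unitInterval := pinW K (↑F : Set (Sym2 (Fin n))) (∅ : Set (Sym2 (Fin n))) with hw₀
    have hF : ∀ e ∈ F, ∃ v ∈ N, ∃ a ∉ N, e = s(v, a) := by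
      intro e he
      obtain ⟨⟨v, a⟩, hva, rfl⟩ := Finset.mem_image.1 he
      obtain ⟨hv, ha⟩ := Finset.mem_product.1 hva
      exact ⟨v, hv, a, Finset.disjoint_left.1 hNA.symm ha, rfl⟩
    have hin : ∀ e : Sym2 (Fin n), (∀ z ∈ e, z ∉ N) → w₀ e = q e := by
      intro e he
      have heF : e ∉ (↑F : Set (Sym2 (Fin n))) := by
        intro heF
        obtain ⟨v, hv, a, -, rfl⟩ := hF e (Finset.mem_coe.1 heF)
        exact he v (Sym2.mem_mk_left v a) hv
      rw [hw₀, pinW_apply_of_not_mem K _ heF]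
      have h2 : ¬ (∃ y ∈ e, y ∈ N) := fun ⟨y, hy, hyN⟩ => he y hy hyN
      simp only [hq, h2, if_false]
    have hw₀cut : ∀ u : Fin n, u ∉ N → ∀ v ∈ N, w₀ s(u, v) = 0 := by
      intro u hu v hv
      by_cases huA : u ∈ A
      · have he : s(u, v) ∈ (↑F : Set (Sym2 (Fin n))) := by
          refine Finset.mem_coe.2 (Finset.mem_image.2 ⟨(v, u), Finset.mem_product.2 ⟨hv, huA⟩, ?_⟩)
          exact Sym2.eq_swap
        rw [hw₀, pinW_apply_of_mem_of_not_mem K he (Set.notMem_empty _)]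
      · have he : s(u, v) ∉ (↑F : Set (Sym2 (Fin n))) := by
          intro heF
          obtain ⟨⟨v', a'⟩, hva, he'⟩ := Finset.mem_image.1 (Finset.mem_coe.1 heF)
          obtain ⟨hv', ha'⟩ := Finset.mem_product.1 hva
          dsimp only at he'
          rcases Sym2.eq_iff.1 he' with ⟨h1, h2⟩ | ⟨h1, h2⟩
          · exact hu (h1 ▸ hv')
          · exact huA (h2 ▸ ha')
        rw [hw₀, pinW_apply_of_not_mem K _ he]
        have := hfree v hv u huA hu
        rw [Sym2.eq_swap]
        exact Subtype.ext (by exact_mod_cast this)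
    have hqcut : ∀ u : Fin n, u ∉ N → ∀ v ∈ N, q s(u, v) = 0 := by
      intro u hu v hv
      have : ∃ y ∈ s(u, v), y ∈ N := ⟨v, Sym2.mem_mk_right u v, hv⟩
      simp only [hq, this, if_true]
    have hloc : ∀ y : Fin n, y ∉ N → (prodBernoulli w₀).real (openConn y b) = (prodBernoulli q).real (openConn y b) :=
      fun y hy => openConn_real_eq_offBlock w₀ q N b hy hin hw₀cut hqcut
    -- `μ_K(Rᶜ ∩ v b) = μ_K(Rᶜ) · μ_q(v b)` for `v ∉ N`
    have hRF : R = {ω | ∃ e ∈ F, e ∈ ω} := fingerContact_R_eq N A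
    have hoff : ∀ y : Fin n, y ∉ N → (prodBernoulli K).real (openConn y b ∩ Rᶜ) =
        (prodBernoulli K).real Rᶜ * (prodBernoulli q).real (openConn y b) := by
      intro y hy
      rw [hRF, notSomeOpen_eq_localCylinder F, prodBernoulli_real_inter_localCylinder K F (∅ : Set (Sym2 (Fin n))) (hmeas _),
        ← hw₀, hloc y hy]
    have hsplit : ∀ y : Fin n, (prodBernoulli K).real (openConn y b ∩ R) + (prodBernoulli K).real (openConn y b ∩ Rᶜ) =
        (prodBernoulli K).real (openConn y b) :=
      fun y => measureReal_inter_add_sdiff (μ := prodBernoulli K) (s := openConn y b) (hmeas R)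
    have hdN : d ∉ N := Finset.disjoint_left.1 hNA.symm hd
    have hstep1 : (prodBernoulli K).real (R ∩ openConn d b) ≤ (prodBernoulli K).real (R ∩ openConn c b) := by
      have h1 := hsplit d
      have h2 := hsplit c
      rw [hoff d hdN] at h1
      rw [hoff c hcN] at h2
      have hmono : (prodBernoulli K).real Rᶜ * (prodBernoulli q).real (openConn c b) ≤
          (prodBernoulli K).real Rᶜ * (prodBernoulli q).real (openConn d b) :=
        mul_le_mul_of_nonneg_left hcd measureReal_nonneg
      have h3 := hle c hc
      rw [Set.inter_comm R (openConn d b), Set.inter_comm R (openConn c b)]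
      linarith
    exact hstep1.trans hstep2

/-- **The T-functional of an UNGLUED finger set is non-negative at the designation.**  Stub setting: with `T_d^K(N) := μ_K(N ↮ A) + μ_K(N ↔ b)
− μ_K(d ↔ b)`, where `N ↮ A` / `N ↔ b` mean no / some vertex of `N` is joined to `A` / `b`, one has `T_d^K(N) ≥ 0`.  Indeed
`μ_K(d↔b) = μ_K(R ∩ d↔b) + μ_K(Rᶜ ∩ d↔b) ≤ μ_K(R ∩ ⋃_v v↔b) + μ_K(Rᶜ) ≤ μ_K(N↔b) + μ_K(N↮A)` (off `R` no finger reaches `A`).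
[cite: KozmaNitzan2024, §3.2 pp. 12–14] -/
theorem T_fingers_unglued_nonneg (K : Sym2 (Fin n) → unitInterval) (A N : Finset (Fin n)) (d b : Fin n)
    (hb : b ∈ A) (hNA : Disjoint N A) (hd : d ∈ A)
    (hfree : ∀ v ∈ N, ∀ y : Fin n, y ∉ A → y ∉ N → (K s(v, y) : ℝ) = 0)
    (hle : ∀ a ∈ A, (prodBernoulli K).real (openConn d b) ≤ (prodBernoulli K).real (openConn a b)) :
    0 ≤ (prodBernoulli K).real (⋃ v ∈ N, ⋃ a ∈ A, openConn v a)ᶜ + (prodBernoulli K).real (⋃ v ∈ N, openConn v b) -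
      (prodBernoulli K).real (openConn d b) := by
  set R : Set (BondConfig (Fin n)) := {ω : Set (Sym2 (Fin n)) | ∃ v ∈ N, ∃ a ∈ A, s(v, a) ∈ ω} with hR
  have hmeas : ∀ s : Set (BondConfig (Fin n)), MeasurableSet s := fun _ => MeasurableSet.of_discrete
  have hmain := fingerML3_unglued K A N d b hb hNA hd hfree hle
  have hsplit := measureReal_inter_add_sdiff (μ := prodBernoulli K) (s := openConn d b) (hmeas R)
  -- off `R` no finger reaches a relay
  have hnull := finger_noContact_reach_null K A N hNA hfree
  have hoff : (prodBernoulli K).real (openConn d b \ R) ≤ (prodBernoulli K).real (⋃ v ∈ N, ⋃ a ∈ A, openConn v a)ᶜ := by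
    have hle1 : (prodBernoulli K).real (openConn d b \ R) ≤ (prodBernoulli K).real Rᶜ :=
      measureReal_mono fun ω hω => hω.2
    have hsplit2 := measureReal_inter_add_sdiff (μ := prodBernoulli K) (s := Rᶜ) (hmeas (⋃ v ∈ N, ⋃ a ∈ A, openConn v a))
    have hz : (prodBernoulli K).real (Rᶜ ∩ ⋃ v ∈ N, ⋃ a ∈ A, openConn v a) = 0 := hnull
    have hle2 : (prodBernoulli K).real (Rᶜ \ ⋃ v ∈ N, ⋃ a ∈ A, openConn v a) ≤
        (prodBernoulli K).real (⋃ v ∈ N, ⋃ a ∈ A, openConn v a)ᶜ :=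
      measureReal_mono fun ω hω => hω.2
    linarith
  have hin : (prodBernoulli K).real (R ∩ ⋃ v ∈ N, openConn v b) ≤ (prodBernoulli K).real (⋃ v ∈ N, openConn v b) :=
    measureReal_mono Set.inter_subset_right (measure_ne_top _ _)
  rw [Set.inter_comm] at hmain
  linarith

end FingerUnglued

end

end Summit.CriticalPhenomena.PercolationContinuityZ3.Theorems
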